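/-
Copyright (c) 2026 the pub-hodgecm-mathlib formalisation cell (harness21).  Prover seat hodgecm-mathlib-R90-IF-p01 (g0), programme R90-TF, section S9 «InnerForm-13.3.6 (c)»,
deal «G′-DATUM FIELDS», EDITION 2 — the LAWS of the packets of record (the ◇-pins `hmem` ∕ `hmemU` ∕ `hevp` of ★ `R90.S9.sec146_of_parts` at the concrete datum).
-/
import Summits.HodgeConjecture.HodgeConjecture.Theorems.R90S9InnerFormSec146Packets       -- (this seat, edition 2): `PacketPrime`, `memPrime`, `packetOfPrime`, `evp`, `evpRep`, law-predicates
import Summits.HodgeConjecture.HodgeConjecture.Theorems.R90S5HasFinComponentOfDiscrete    -- ★ `R90.S5.admUnitConstituents_nonempty_of_anisotropic`; brings ★ `R90.S9.flath_of_anisotropic`, «AFA», T♭-core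
import HarnessLib

/-!
# R90-TF · S9 — the packets of `G′ = U(H)` of record, `H` ANISOTROPIC: every discrete class lies in exactly one packet, and `t(Π′) = t(π′)` for `π′ ∈ Π′`
# (Rogawski 1990 §13.1 p. 199, §14.6 p. 242; Flath 1979 Thm. 3)

Cell `hodgecm-mathlib`, crux H413 = `stmt-HodgeConjecture-24833` (supports-only, count-neutral), route `HCCMUnconditional`; programme R90-TF, section S9, seat R90-IF-p01 (g0).
THEOREMS ONLY (`--kind proof`); no def, no instance, no named-fact hypothesis, no `sorry`.  These are the ◇-pins `hmem` ∕ `hmemU` ∕ `hevp` of ★ p862147 `R90.S9.sec146_of_parts`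
READ AT THE CONCRETE DATUM of ★ `R90S9InnerFormSec146Data` + `R90S9InnerFormSec146Packets` (`Rep′ := RepPrimeClass`, `m′ := mPrime`, `Packet′ := PacketPrime Ξ`,
`mem′ := memPrime`, `evp`, `evpRep`), for `H` anisotropic (the definite inner form of (B4)):
* §1 `eq_clFinChoice_of_isConstituentOf` — at an anisotropic `H` THE local component: every `v`-constituent class of a discrete `P` is ★ `clFinChoice P v` («AFA» ★
  `R90.S9.automorphicFlathAdmissible_of_anisotropic` + local isotypy ★ `isConstituentOf_comp_inclPlace_subsingleton`, Flath); `localConstituentsIn_iff_forall_clFinChoice_mem`.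
* §2 ◇`hmem`: **`memPrime_packetOfPrime`** (`π′ ∈` its packet of record), `exists_memPrime`.
* §3 ◇`hmemU` modulo the law «in at most one» for the A-packets of record: `eq_of_isLocalPacketOfRecordAt_of_mem` (local), **`memPrime_unique`** (global), `eq_packetOfPrime_of_memPrime`.
* §4 ◇`hevp` modulo «`πˢ(ξ_v)` ramified a.e.»: `eventually_clFinChoice_eq_πn_of_memPrime` ((FLATH) ★ `R90.S9.flath_of_anisotropic`), **`evpRep_iff_evp_of_memPrime`**.
HONEST LABEL: no printed statement about automorphic forms beyond these bookkeeping laws is proved; HC_CM is proved only modulo the 7 printed citations (2 remaining named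
inputs: hLiu418 = `stmt-HodgeConjecture-24832`, h413 = `stmt-HodgeConjecture-24833`) until rung 0 closes.

## References
* [Rogawski1990] J. D. Rogawski, *Automorphic Representations of Unitary Groups in Three Variables*, Ann. of Math. Stud. 123 (1990), §13.1 p. 199; §13.3 p. 201,
  Thm. 13.3.5 p. 202; §14.5 p. 237; §14.6 p. 242; §12.2 p. 174.
* [FlathCorvallis1979] D. Flath, *Decomposition of representations into tensor products*, Proc. Sympos. Pure Math. 33.1 (1979), Thm. 3.
-/

set_option autoImplicit false
set_option linter.dupNamespace false  -- the mandated namespace repeats the summit's segment (`HodgeConjecture.HodgeConjecture`)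

noncomputable section

open NumberField IsDedekindDomain MeasureTheory Filter
open scoped Matrix MatrixGroups
open Literature.NumberTheory Literature.NumberTheory.Automorphic Literature.NumberTheory.Automorphic.UnitaryGroup
open Literature.NumberTheory.Rogawski1990
open Summit.HodgeConjecture.HodgeConjecture.Cruxes.H413 Summit.HodgeConjecture.HodgeConjecture.Cruxes.H413.F0P3ClassTokenChoice
open Summit.HodgeConjecture.HodgeConjecture.Cruxes.H413.F0P3GlobalPacket Summit.HodgeConjecture.HodgeConjecture.Cruxes.H413.F0P3LocalPacketKit
open Summit.HodgeConjecture.HodgeConjecture.Cruxes.H413.F0P3FinComponentTokens Summit.HodgeConjecture.HodgeConjecture.Cruxes.H413.F0P3FinPartConstituentTransfer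

namespace Summit.HodgeConjecture.HodgeConjecture.R90.S9.InnerFormSec146

variable (L : Type) [Field L] [NumberField L] [IsCMField L] (H : Matrix (Fin 3) (Fin 3) L) {H' : Matrix (Fin 3) (Fin 3) L}
  (μA : Measure (adelicGroupData (↥(maximalRealSubfield L)) L (IsCMField.complexConj L) 3 H).automorphicQuotient)
  [(adelicGroupData (↥(maximalRealSubfield L)) L (IsCMField.complexConj L) 3 H).IsAutomorphicMeasure μA]
  (Ξ : OneDimAutRepH L → PacketPrimeFin L H)

/-! ## §1 At an anisotropic `H`, THE local component: every `v`-constituent is the chosen class -/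

/-- **At an anisotropic `H` every `v`-constituent class of a discrete `P` is ★ `clFinChoice P v`**: «AFA» (★ `R90.S9.automorphicFlathAdmissible_of_anisotropic`) gives an
irreducible admissible finite component `σ`, whose `v`-constituents are those of `P` (★ `smoothConstituents_iff_of_hasFinComponent`) and form a subsingleton (★
`isConstituentOf_comp_inclPlace_subsingleton`, Flath); and `clFinChoice P v` IS a constituent (★ `R90.S5.admUnitConstituents_nonempty_of_anisotropic`).
[cite: FlathCorvallis1979, Thm. 3] [cite: Rogawski1990, §14.5 p. 237] -/
theorem eq_clFinChoice_of_isConstituentOf (hanis : ∀ x : Fin 3 → L, Literature.AlgebraicGeometry.ShimuraVarieties.hermForm (cmConjRingHom L) H x x = 0 → x = 0)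
    (P : DiscreteAutomorphicRep (adelicGroupData (↥(maximalRealSubfield L)) L (IsCMField.complexConj L) 3 H) μA) (v : HeightOneSpectrum (𝓞 ↥(maximalRealSubfield L)))
    (c : IrrClass ((cmDatum L 3 H).Local v))
    (hc : (IrrClass.comap (localPiEquiv L (IsCMField.complexConj L) 3 H v) c).IsConstituentOf
      (P.finRep.smoothPart.toRepresentation.comp (inclPlace (↥(maximalRealSubfield L)) L (IsCMField.complexConj L) 3 H v))) :
    c = clFinChoice P v := by
  obtain ⟨W, _, _, σ, hirr, hadm, hP⟩ := R90.S9.automorphicFlathAdmissible_of_anisotropic L 3 H hanis μA P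
  have h₁ := clFinChoice_isConstituentOf_of_nonempty P v (R90.S5.admUnitConstituents_nonempty_of_anisotropic L H μA hanis P v)
  exact IrrClass.comap_injective (localPiEquiv L (IsCMField.complexConj L) 3 H v)
    (isConstituentOf_comp_inclPlace_subsingleton hirr hadm v ((smoothConstituents_iff_of_hasFinComponent P hirr hadm hP v _).1 hc)
      ((smoothConstituents_iff_of_hasFinComponent P hirr hadm hP v _).1 h₁))

/-- **`LocalConstituentsIn P Pk` ⟺ `clFinChoice P v ∈ Pk v` for all `v`** (anisotropic `H`). [cite: FlathCorvallis1979, Thm. 3] [cite: Rogawski1990, §13.3 p. 201] -/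
theorem localConstituentsIn_iff_forall_clFinChoice_mem
    (hanis : ∀ x : Fin 3 → L, Literature.AlgebraicGeometry.ShimuraVarieties.hermForm (cmConjRingHom L) H x x = 0 → x = 0)
    (P : DiscreteAutomorphicRep (adelicGroupData (↥(maximalRealSubfield L)) L (IsCMField.complexConj L) 3 H) μA) (Pk : PacketPrimeFin L H) :
    LocalConstituentsIn P Pk ↔ ∀ v : HeightOneSpectrum (𝓞 ↥(maximalRealSubfield L)), clFinChoice P v ∈ (Pk v).members := by
  refine ⟨fun h v => h v _ (clFinChoice_isConstituentOf_of_nonempty P v (R90.S5.admUnitConstituents_nonempty_of_anisotropic L H μA hanis P v)),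
    fun h v c hc => ?_⟩
  rw [eq_clFinChoice_of_isConstituentOf L H μA hanis P v c hc]
  exact h v

/-! ## §2 ◇`hmem`: every discrete class lies in its packet of record -/

/-- **◇`hmem` — `π′ ∈` (the packet of record of `π′`)**, for `π′ = [P]`, `H` anisotropic. [cite: Rogawski1990, §13.1 p. 199 «lies in at least one packet»; §14.6 p. 242] -/
theorem memPrime_packetOfPrime (hanis : ∀ x : Fin 3 → L, Literature.AlgebraicGeometry.ShimuraVarieties.hermForm (cmConjRingHom L) H x x = 0 → x = 0)
    (P : DiscreteAutomorphicRep (adelicGroupData (↥(maximalRealSubfield L)) L (IsCMField.complexConj L) 3 H) μA) :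
    memPrime L H μA Ξ (classOf L H μA P) (packetOfPrime L H μA Ξ (classOf L H μA P)) := by
  rw [memPrime_iff, finOf_packetOfPrime, packetOfFin_classOf, memPrimeFin_classOf, localConstituentsIn_iff_forall_clFinChoice_mem L H μA hanis]
  exact fun v => mem_packetOfClassAt L H Ξ v (clFinChoice P v)

/-- **◇`hmem` as the cut reads it**: every class `π′` (all of them have `m′ π′ ≠ 0`, ★ `mPrime_ne_zero`) lies in some packet. [cite: Rogawski1990, §14.6 p. 242 ll. 13–14] -/
theorem exists_memPrime (hanis : ∀ x : Fin 3 → L, Literature.AlgebraicGeometry.ShimuraVarieties.hermForm (cmConjRingHom L) H x x = 0 → x = 0)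
    (π' : RepPrimeClass L H μA) : ∃ X : PacketPrime L H μA Ξ, memPrime L H μA Ξ π' X := by
  induction π' using Quotient.inductionOn with | h P => ?_
  exact ⟨packetOfPrime L H μA Ξ (classOf L H μA P), memPrime_packetOfPrime L H μA Ξ hanis P⟩

/-! ## §3 ◇`hmemU`: uniqueness of the packet, modulo «in at most one» for the A-packets of record -/

/-- **Two local packets of record with a common member coincide**, given «in at most one» for the A-packets of record at `v` (the singleton packets are, by definition, through
classes lying in no A-packet of record). [cite: Rogawski1990, §13.1 p. 199 l. 17] -/
theorem eq_of_isLocalPacketOfRecordAt_of_mem {v : HeightOneSpectrum (𝓞 ↥(maximalRealSubfield L))} (hD : APacketsOfRecordDisjointAt L H Ξ v)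
    {Q Q' : CMLocalAPacket L H v} (hQ : IsLocalPacketOfRecordAt L H Ξ v Q) (hQ' : IsLocalPacketOfRecordAt L H Ξ v Q')
    {c : IrrClass ((cmDatum L 3 H).Local v)} (hc : c ∈ Q.members) (hc' : c ∈ Q'.members) : Q = Q' := by
  rcases hQ with ⟨ξ, rfl⟩ | ⟨hs, hno⟩ <;> rcases hQ' with ⟨ξ', rfl⟩ | ⟨hs', hno'⟩
  · exact hD ξ ξ' c hc hc'
  · rw [Q'.members_of_πs_eq_none hs', Set.mem_singleton_iff] at hc'
    exact absurd (hc' ▸ hc) (hno' ξ)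
  · rw [Q.members_of_πs_eq_none hs, Set.mem_singleton_iff] at hc
    exact absurd (hc ▸ hc') (hno ξ')
  · rw [Q.members_of_πs_eq_none hs, Set.mem_singleton_iff] at hc
    rw [Q'.members_of_πs_eq_none hs', Set.mem_singleton_iff] at hc'
    exact LocalAPacket.ext' (hc.symm.trans hc') (hs.trans hs'.symm)

/-- **◇`hmemU` — a discrete class lies in at most one packet**, `H` anisotropic, modulo «in at most one» for the A-packets of record at every `v`: the two packets share the
member `clFinChoice P v` at each `v` (§1), so their local packets coincide (`eq_of_isLocalPacketOfRecordAt_of_mem`), hence the packets (`finOf_injective`).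
[cite: Rogawski1990, §13.1 p. 199 l. 17; §13.3 Thm. 13.3.5 p. 202; §14.6 p. 242] -/
theorem memPrime_unique (hanis : ∀ x : Fin 3 → L, Literature.AlgebraicGeometry.ShimuraVarieties.hermForm (cmConjRingHom L) H x x = 0 → x = 0)
    (hD : ∀ v : HeightOneSpectrum (𝓞 ↥(maximalRealSubfield L)), APacketsOfRecordDisjointAt L H Ξ v)
    (π' : RepPrimeClass L H μA) (X Y : PacketPrime L H μA Ξ) (hX : memPrime L H μA Ξ π' X) (hY : memPrime L H μA Ξ π' Y) : X = Y := by
  induction π' using Quotient.inductionOn with | h P => ?_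
  refine finOf_injective L H μA Ξ (funext fun v => ?_)
  have hX' := (localConstituentsIn_iff_forall_clFinChoice_mem L H μA hanis P _).1 hX v
  have hY' := (localConstituentsIn_iff_forall_clFinChoice_mem L H μA hanis P _).1 hY v
  exact eq_of_isLocalPacketOfRecordAt_of_mem L H Ξ (hD v) (isLocalPacketOfRecordAt_finOf L H μA Ξ X v) (isLocalPacketOfRecordAt_finOf L H μA Ξ Y v) hX' hY'

/-- **The packet containing `π′` IS its packet of record.** [cite: Rogawski1990, §13.1 p. 199; §14.6 p. 242] -/
theorem eq_packetOfPrime_of_memPrime (hanis : ∀ x : Fin 3 → L, Literature.AlgebraicGeometry.ShimuraVarieties.hermForm (cmConjRingHom L) H x x = 0 → x = 0)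
    (hD : ∀ v : HeightOneSpectrum (𝓞 ↥(maximalRealSubfield L)), APacketsOfRecordDisjointAt L H Ξ v)
    (P : DiscreteAutomorphicRep (adelicGroupData (↥(maximalRealSubfield L)) L (IsCMField.complexConj L) 3 H) μA) (X : PacketPrime L H μA Ξ)
    (hX : memPrime L H μA Ξ (classOf L H μA P) X) : X = packetOfPrime L H μA Ξ (classOf L H μA P) :=
  memPrime_unique L H μA Ξ hanis hD _ X _ hX (memPrime_packetOfPrime L H μA Ξ hanis P)

/-! ## §4 ◇`hevp`: `t(Π′) = t(π′)` for `π′ ∈ Π′`, modulo «`πˢ(ξ_v)` ramified for almost all `v`» -/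

/-- **For `π′ = [P] ∈ Π′`, the chosen class IS the `πⁿ`-slot of `Π′_v` for almost all `v`**: a.e. every constituent of `P` is `K_v`-spherical ((FLATH) ★
`R90.S9.flath_of_anisotropic`), it is a member of the packet of record `Π′_v`, and the `πˢ`-slots of record are a.e. ramified (hypothesis).
[cite: FlathCorvallis1979, Thm. 3] [cite: Rogawski1990, §14.6 p. 242; §12.2 p. 174] -/
theorem eventually_clFinChoice_eq_πn_of_memPrime
    (hanis : ∀ x : Fin 3 → L, Literature.AlgebraicGeometry.ShimuraVarieties.hermForm (cmConjRingHom L) H x x = 0 → x = 0)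
    (hS : PisSlotsNotSphericalCofinite L H Ξ)
    (P : DiscreteAutomorphicRep (adelicGroupData (↥(maximalRealSubfield L)) L (IsCMField.complexConj L) 3 H) μA) (X : PacketPrime L H μA Ξ)
    (hX : memPrime L H μA Ξ (classOf L H μA P) X) :
    ∀ᶠ v : HeightOneSpectrum (𝓞 ↥(maximalRealSubfield L)) in cofinite, clFinChoice P v = (finOf L H μA Ξ X v).πn := by
  filter_upwards [R90.S9.flath_of_anisotropic L H hanis μA P, hS] with v hvF hvS
  have hmem := (localConstituentsIn_iff_forall_clFinChoice_mem L H μA hanis P _).1 hX v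
  have hsph : (clFinChoice P v).IsSpherical (cmLocalIntegralLevel L 3 H v) :=
    hvF _ (clFinChoice_isConstituentOf_of_nonempty P v (R90.S5.admUnitConstituents_nonempty_of_anisotropic L H μA hanis P v))
  rcases (LocalAPacket.mem_members_iff _ _).1 hmem with h | h
  · exact h
  · exfalso
    rcases isLocalPacketOfRecordAt_finOf L H μA Ξ X v with ⟨ξ, hξ⟩ | ⟨hs, -⟩
    · exact hvS ξ (clFinChoice P v) (hξ ▸ h) hsph
    · rw [hs] at h
      exact Option.some_ne_none _ h.symm

/-- **◇`hevp` — «the e.v.p. `t(Π′)` coincides with `t(π′)`» for `π′ ∈ Π′**: `evpRep π′ Π ↔ evp Π′ Π`, `H` anisotropic, modulo «`πˢ(ξ_v)` ramified a.e.» (both sides read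
«transports to `sph Π_v`» at almost all `v`, of the SAME class by `eventually_clFinChoice_eq_πn_of_memPrime`). [cite: Rogawski1990, §14.6 p. 242 ll. 6–8; §13.7 p. 206] -/
theorem evpRep_iff_evp_of_memPrime (hanis : ∀ x : Fin 3 → L, Literature.AlgebraicGeometry.ShimuraVarieties.hermForm (cmConjRingHom L) H x x = 0 → x = 0)
    (hS : PisSlotsNotSphericalCofinite L H Ξ) (𝔩 : ∀ v : HeightOneSpectrum (𝓞 ↥(maximalRealSubfield L)), LocalPacketKit L H' v)
    (π' : RepPrimeClass L H μA) (X : PacketPrime L H μA Ξ) (hX : memPrime L H μA Ξ π' X) (Pg : GlobalPacket 𝔩) :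
    evpRep L H μA 𝔩 π' Pg ↔ evp L H μA Ξ 𝔩 X Pg := by
  induction π' using Quotient.inductionOn with | h P => ?_
  change evpRepOf L H μA 𝔩 P Pg ↔ evpFin L H 𝔩 (finOf L H μA Ξ X) Pg
  unfold evpRepOf evpFin
  exact Filter.eventually_congr ((eventually_clFinChoice_eq_πn_of_memPrime L H μA Ξ hanis hS P X hX).mono fun v hv => by rw [hv])

end Summit.HodgeConjecture.HodgeConjecture.R90.S9.InnerFormSec146

end
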